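import Summits.ResolutionOfSingularities.ResolutionOfSingularities.Theorems.DeltaCutRef4
import HarnessLib

/-!
# DeltaCutRefCells — decomp-res node «RefCut» (lens-6 g27, critic row 204 CLEARED (F-curve WHOLE) DECIDED +1 · MAP
0), tree file 5/5 of the node

Content VERBATIM from the decomp-res lens-6 g27 node `HOME/decomp-res-lens-6/g27/RefCut.lean` (pin df7099b8; no
carry, imports the landed `DeltaCutSepCells` + Literature; namespace `…Theorems.DeltaCutClasses`); HOME =
run/shared/lean/pub/decomp-res; critic CRITIC-LEDGER row 204 CLEARED (F-curve WHOLE) DECIDED +1 · MAP 0; landing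
orders NEXT-g28.md §4 + INBOX :1315 (09:51:49Z) — provenance, critic text and the lens header in full in the first
file of the node, `DeltaCutRef`.  `--kind proof --supports stmt-ResolutionOfSingularities-26971`.

## This file

§RefCells — THE CELLS AND THE EXACT RE-LOCATION (plan file (E); cn26 cells BY NAME, binders of `WORTopSepHeavy n`
VERBATIM): `WORTopSepHeavyRefTame n` / `WORTopRefHeavy n`, families `E1TopSepHeavyRefTame` [DECIDED:
`worTopSepHeavyRefTame_of_five`, `e1TopSepHeavyRefTame_of_five (h5 : E 5)`] and **`E1TopRefHeavy`** [THE LOCATED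
RESIDUAL of the lens-6 column after g27; cone-free HOME = this file]; the hypothesis-free carve
`worTopSepHeavy_iff_refHeavy_refTame` / `e1TopSepHeavy_iff_refHeavy_refTame`; the RE-LOCATION
`e1TopSepHeavy_iff_e1TopRefHeavy (h5 : E 5)` / `worTopSepHeavy_iff_worTopRefHeavy` and the column chain
`worTopRunHeavy_iff_worTopRefHeavy`, `e1TopRunHeavy_iff_` / `e1TopChainHeavy_iff_` / `e1TopDeltaHeavy_iff_` /
`e1TopHeavy_iff_` / `e1TopNoAbs_iff_` / `e_one_iff_e1TopRefHeavy`; the kinds `WORTopRefFrozen n` /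
`WORTopRefPerpetual n`, `E1TopRefFrozen` [kind F-surface · NO INHABITANT] / `E1TopRefPerpetual` [kind P′ ·
UNDECIDED], `worTopRefHeavy_iff_surface_perpetual` / `e1TopRefHeavy_iff_surface_perpetual`; the ALIAS
`sepFrozen_curve_refMoves` of `SepFrozen.refMoves_of_dimLEOne` is NOT re-landed (writer note in place).

[WRITER NOTE (decomp-res writer g13): file split only (tree files ≤ 400 lines; the plan's section groups, cut
further by the cap at declaration boundaries); namespace, sections, section `open`s / `variable`s and every
declaration exactly as in the lens (the node's HOME-only dupNamespace-linter line is dropped — the library sets it;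
`noncomputable section`, the two file-level `open` lines, `universe u` and the namespace-level `open
…TwistCutClasses` / `open …LightCutClasses` of the node are replayed in every file).]

(Sources: Hironaka1964; Kollar2007 Thm. 1.101; Lipman1978 §1; CossartJannsenSaito2020 §5–§6, Def. 3.13 / Thm. 3.14;
CossartPiltant2019 Prop. 2.6; EGAIV2 §7.8; BierstoneGrigorievMilmanWlodarczyk2011 §3; Hironaka1967; Giraud1975.)
-/

noncomputable section

open CategoryTheory CategoryTheory.Limits AlgebraicGeometry TopologicalSpace IsLocalRing
open Literature.AlgebraicGeometry.Resolution

universe u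

namespace Summit.ResolutionOfSingularities.ResolutionOfSingularities.Theorems.DeltaCutClasses

open Summit.ResolutionOfSingularities.ResolutionOfSingularities.Theorems.TwistCutClasses
open Summit.ResolutionOfSingularities.ResolutionOfSingularities.Theorems.LightCutClasses

section RefCells

open Summit.ResolutionOfSingularities.ResolutionOfSingularities.Theorems
open WeakOrderReduction ForcedTowerClasses SubfieldContactClasses AbsoluteContactClasses PurityValveClasses

/-! ### §RefCells — THE CELLS OF THE REFINED CUT: the EXACT hypothesis-free carve of `WORTopSepHeavy` / `E1TopSepHeavy` (binders
VERBATIM), the decided side PROVED from five, the RE-LOCATION of the residual, the edges down to `E 1`, and the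
residual's two kinds
F-surface / P′ -/

/-- **THE DECIDED CELL · `WORTopSepHeavyRefTame n`** — weak resolution for g26's residual base data at marking `n`
(canonical bad run
AND separating run not terminating) whose REFINED RUN TERMINATES.  DECIDED (PROVED below from `SeqDimFour 5 n` by
`wor_of_refTerminates`; inhabited by C× = `z³ + t⁴ + u⁴w⁴`, char 3: §RefCertificates). -/
def WORTopSepHeavyRefTame (n : ℕ) : Prop :=
  ∀ p : ℕ, p.Prime → ∀ (k : Type) [Field k] [CharP k p] (Y : Scheme.{0}) (g : Y ⟶ Spec (.of k)),
    IsBase Y g → ∀ M : MarkedIdeal Y, IsDatum n M → TopHeavy Y M.ideal n → TopDeltaHeavy Y M.ideal n →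
      TopChainHeavy Y M.ideal n → ¬ RunTerminates n ⟨Y, M.ideal⟩ → ¬ SepTerminates n ⟨Y, M.ideal⟩ →
        RefTerminates n ⟨⟨Y, M.ideal⟩, none⟩ → ∃ t : CentreSeq Y, WeakResolution t M

/-- **THE RESIDUAL CELL · `WORTopRefHeavy n`** — weak resolution for g26's residual base data at marking `n` whose
REFINED RUN does
NOT terminate (it FREEZES at a nonempty bad locus whose irregular reduced closure has dimension `≥ 2` — kind F-surface, no
inhabitant known —, or is PERPETUAL — kind P′, no inhabitant known; exact: `not_refTerminates_iff`).  RESIDUAL (the located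
successor of `WORTopSepHeavy n`). -/
def WORTopRefHeavy (n : ℕ) : Prop :=
  ∀ p : ℕ, p.Prime → ∀ (k : Type) [Field k] [CharP k p] (Y : Scheme.{0}) (g : Y ⟶ Spec (.of k)),
    IsBase Y g → ∀ M : MarkedIdeal Y, IsDatum n M → TopHeavy Y M.ideal n → TopDeltaHeavy Y M.ideal n →
      TopChainHeavy Y M.ideal n → ¬ RunTerminates n ⟨Y, M.ideal⟩ → ¬ SepTerminates n ⟨Y, M.ideal⟩ →
        ¬ RefTerminates n ⟨⟨Y, M.ideal⟩, none⟩ → ∃ t : CentreSeq Y, WeakResolution t M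

/-- **THE DECIDED family · `E1TopSepHeavyRefTame`**. DECIDED. -/
def E1TopSepHeavyRefTame : Prop := ∀ n : ℕ, 1 ≤ n → WORTopSepHeavyRefTame n

/-- **THE RESIDUAL (family) · `E1TopRefHeavy`** — THE LOCATED RESIDUAL of the lens-6 column after g27. RESIDUAL. -/
def E1TopRefHeavy : Prop := ∀ n : ℕ, 1 ≤ n → WORTopRefHeavy n

/-- **EXACT CARVE at one marking** (hypothesis-free): `WORTopSepHeavy n ⟺ WORTopRefHeavy n ∧ WORTopSepHeavyRefTame n`
(excluded middle on `RefTerminates`). [new] [folklore] -/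
theorem worTopSepHeavy_iff_refHeavy_refTame (n : ℕ) :
    WORTopSepHeavy n ↔ WORTopRefHeavy n ∧ WORTopSepHeavyRefTame n := by
  constructor
  · intro h
    exact ⟨fun p hp k _ _ Y g hB M hM hT hD hC hr hs _ => h p hp k Y g hB M hM hT hD hC hr hs,
      fun p hp k _ _ Y g hB M hM hT hD hC hr hs _ => h p hp k Y g hB M hM hT hD hC hr hs⟩
  · rintro ⟨hR, hD⟩ p hp k _ _ Y g hB M hM hT hDH hC hr hs
    by_cases ht : RefTerminates n ⟨⟨Y, M.ideal⟩, none⟩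
    · exact hD p hp k Y g hB M hM hT hDH hC hr hs ht
    · exact hR p hp k Y g hB M hM hT hDH hC hr hs ht

/-- **EXACT CARVE of the family** (hypothesis-free): `E1TopSepHeavy ⟺ E1TopRefHeavy ∧ E1TopSepHeavyRefTame`. [new] [folklore] -/
theorem e1TopSepHeavy_iff_refHeavy_refTame : E1TopSepHeavy ↔ E1TopRefHeavy ∧ E1TopSepHeavyRefTame := by
  constructor
  · intro h
    exact ⟨fun n hn => ((worTopSepHeavy_iff_refHeavy_refTame n).1 (h n hn)).1,
      fun n hn => ((worTopSepHeavy_iff_refHeavy_refTame n).1 (h n hn)).2⟩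
  · rintro ⟨hR, hD⟩ n hn
    exact (worTopSepHeavy_iff_refHeavy_refTame n).2 ⟨hR n hn, hD n hn⟩

/-- **THE DECIDED CELL IS PROVED from `SeqDimFour 5 n`.** [new] [folklore] -/
theorem worTopSepHeavyRefTame_of_five {n : ℕ} (hn : 1 ≤ n) (h5 : SeqDimFour 5 n) : WORTopSepHeavyRefTame n :=
  fun p hp k _ _ Y g hB M hM _ _ _ _ _ ht => wor_of_refTerminates hn h5 p hp k Y g hB M hM ht

/-- **THE DECIDED family is PROVED from `E 5`** (tree: `E 5` ⟸ CJS (R), `e_five_of_RCJS`). [new] [folklore] -/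
theorem e1TopSepHeavyRefTame_of_five (h5 : E 5) : E1TopSepHeavyRefTame :=
  fun n hn => worTopSepHeavyRefTame_of_five hn (h5 n hn)

/-- **RE-LOCATION OF THE RESIDUAL (rule (C))**: under `E 5`, `E1TopSepHeavy ⟺ E1TopRefHeavy` — g26's located
residual is EQUIVALENT
to its typed sub-class «the refined run does not terminate either», STRICTLY smaller as a class of data (C× is
g26-residual of kind
F and g27-decided: §RefCertificates). [new] [folklore] -/
theorem e1TopSepHeavy_iff_e1TopRefHeavy (h5 : E 5) : E1TopSepHeavy ↔ E1TopRefHeavy :=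
  ⟨fun h => (e1TopSepHeavy_iff_refHeavy_refTame.1 h).1,
    fun h => e1TopSepHeavy_iff_refHeavy_refTame.2 ⟨h, e1TopSepHeavyRefTame_of_five h5⟩⟩

/-- Per marking: under `SeqDimFour 5 n`, `WORTopSepHeavy n ⟺ WORTopRefHeavy n`. [new] [folklore] -/
theorem worTopSepHeavy_iff_worTopRefHeavy {n : ℕ} (hn : 1 ≤ n) (h5 : SeqDimFour 5 n) :
    WORTopSepHeavy n ↔ WORTopRefHeavy n :=
  ⟨fun h => ((worTopSepHeavy_iff_refHeavy_refTame n).1 h).1,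
    fun h => (worTopSepHeavy_iff_refHeavy_refTame n).2 ⟨h, worTopSepHeavyRefTame_of_five hn h5⟩⟩

/-- g25's residual: under `E 5`, `E1TopRunHeavy ⟺ E1TopRefHeavy` (g26 `e1TopRunHeavy_iff_e1TopSepHeavy` ∘ g27).
[new] [folklore] -/
theorem e1TopRunHeavy_iff_e1TopRefHeavy (h5 : E 5) : E1TopRunHeavy ↔ E1TopRefHeavy :=
  (e1TopRunHeavy_iff_e1TopSepHeavy h5).trans (e1TopSepHeavy_iff_e1TopRefHeavy h5)

/-- Per marking: under `SeqDimFour 5 n`, `WORTopRunHeavy n ⟺ WORTopRefHeavy n`. [new] [folklore] -/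
theorem worTopRunHeavy_iff_worTopRefHeavy {n : ℕ} (hn : 1 ≤ n) (h5 : SeqDimFour 5 n) :
    WORTopRunHeavy n ↔ WORTopRefHeavy n :=
  (worTopRunHeavy_iff_worTopSepHeavy hn h5).trans (worTopSepHeavy_iff_worTopRefHeavy hn h5)

/-- g24's residual: under `E 5`, `E1TopChainHeavy ⟺ E1TopRefHeavy`. [new] [folklore] -/
theorem e1TopChainHeavy_iff_e1TopRefHeavy (h5 : E 5) : E1TopChainHeavy ↔ E1TopRefHeavy :=
  (e1TopChainHeavy_iff_e1TopSepHeavy h5).trans (e1TopSepHeavy_iff_e1TopRefHeavy h5)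

/-- g23's residual: under `E 5`, `E1TopDeltaHeavy ⟺ E1TopRefHeavy`. [new] [folklore] -/
theorem e1TopDeltaHeavy_iff_e1TopRefHeavy (h5 : E 5) : E1TopDeltaHeavy ↔ E1TopRefHeavy :=
  (e1TopDeltaHeavy_iff_e1TopSepHeavy h5).trans (e1TopSepHeavy_iff_e1TopRefHeavy h5)

/-- **THE WHOLE COLUMN after g27**: under `E 5`, `E1TopHeavy ⟺ E1TopRefHeavy`. [new] [folklore] -/
theorem e1TopHeavy_iff_e1TopRefHeavy (h5 : E 5) : E1TopHeavy ↔ E1TopRefHeavy :=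
  (e1TopHeavy_iff_e1TopSepHeavy h5).trans (e1TopSepHeavy_iff_e1TopRefHeavy h5)

/-- **DOWN-LINK TO ITEM 26971's CLASS**: under `SubfieldContactAbs` and `E 5`, `E1TopNoAbs ⟺ E1TopRefHeavy`. [new] [folklore] -/
theorem e1TopNoAbs_iff_e1TopRefHeavy (hSC : SubfieldContactAbs) (h5 : E 5) : E1TopNoAbs ↔ E1TopRefHeavy :=
  (e1TopNoAbs_iff_e1TopSepHeavy hSC h5).trans (e1TopSepHeavy_iff_e1TopRefHeavy h5)

/-- **SUMMIT EDGE after g27**: under `SubfieldContactAbs` and `E 5`, `E 1 ⟺ E1TopRefHeavy` — the column's ONE open statement is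
the refined residual. [new] [folklore] -/
theorem e_one_iff_e1TopRefHeavy (hSC : SubfieldContactAbs) (h5 : E 5) : E 1 ↔ E1TopRefHeavy :=
  (e_one_iff_e1TopSepHeavy hSC h5).trans (e1TopSepHeavy_iff_e1TopRefHeavy h5)

/-- **RESIDUAL SUB-CELL of KIND F-surface · `WORTopRefFrozen n`** — the refined run FREEZES: at its first motionless
level nothing is
pending, the bad locus is NONEMPTY and its irregular reduced closure has dimension `≥ 2` (no inhabitant known; C×'s closure is a
curve and is resolved instead).  RESIDUAL (kind F-surface). -/
def WORTopRefFrozen (n : ℕ) : Prop :=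
  ∀ p : ℕ, p.Prime → ∀ (k : Type) [Field k] [CharP k p] (Y : Scheme.{0}) (g : Y ⟶ Spec (.of k)),
    IsBase Y g → ∀ M : MarkedIdeal Y, IsDatum n M → TopHeavy Y M.ideal n → TopDeltaHeavy Y M.ideal n →
      TopChainHeavy Y M.ideal n → ¬ RunTerminates n ⟨Y, M.ideal⟩ → ¬ SepTerminates n ⟨Y, M.ideal⟩ →
        RefFrozen n ⟨⟨Y, M.ideal⟩, none⟩ → ∃ t : CentreSeq Y, WeakResolution t M

/-- **RESIDUAL SUB-CELL of KIND P′ · `WORTopRefPerpetual n`** — the refined run is PERPETUAL (every level moves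
forever: separating
hops, and finitely long pending phases by `refRun_pending_phase_ends`; no inhabitant known, none claimed).  RESIDUAL
(kind P′). -/
def WORTopRefPerpetual (n : ℕ) : Prop :=
  ∀ p : ℕ, p.Prime → ∀ (k : Type) [Field k] [CharP k p] (Y : Scheme.{0}) (g : Y ⟶ Spec (.of k)),
    IsBase Y g → ∀ M : MarkedIdeal Y, IsDatum n M → TopHeavy Y M.ideal n → TopDeltaHeavy Y M.ideal n →
      TopChainHeavy Y M.ideal n → ¬ RunTerminates n ⟨Y, M.ideal⟩ → ¬ SepTerminates n ⟨Y, M.ideal⟩ →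
        RefPerpetual n ⟨⟨Y, M.ideal⟩, none⟩ → ∃ t : CentreSeq Y, WeakResolution t M

/-- RESIDUAL kind-F-surface family. RESIDUAL. -/
def E1TopRefFrozen : Prop := ∀ n : ℕ, 1 ≤ n → WORTopRefFrozen n

/-- RESIDUAL kind-P′ family. RESIDUAL. -/
def E1TopRefPerpetual : Prop := ∀ n : ℕ, 1 ≤ n → WORTopRefPerpetual n

/-- **EXACT CARVE OF THE RESIDUAL INTO ITS TWO KINDS** (hypothesis-free; `ref_trichotomy` + exclusivity):
`WORTopRefHeavy n ⟺ WORTopRefFrozen n ∧ WORTopRefPerpetual n`. [new] [folklore] -/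
theorem worTopRefHeavy_iff_surface_perpetual (n : ℕ) :
    WORTopRefHeavy n ↔ WORTopRefFrozen n ∧ WORTopRefPerpetual n := by
  constructor
  · intro h
    exact ⟨fun p hp k _ _ Y g hB M hM hT hD hC hr hs hF =>
        h p hp k Y g hB M hM hT hD hC hr hs ((not_refTerminates_iff n ⟨⟨Y, M.ideal⟩, none⟩).2 (Or.inl hF)),
      fun p hp k _ _ Y g hB M hM hT hD hC hr hs hP =>
        h p hp k Y g hB M hM hT hD hC hr hs ((not_refTerminates_iff n ⟨⟨Y, M.ideal⟩, none⟩).2 (Or.inr hP))⟩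
  · rintro ⟨hF, hP⟩ p hp k _ _ Y g hB M hM hT hD hC hr hs ht
    rcases (not_refTerminates_iff n ⟨⟨Y, M.ideal⟩, none⟩).1 ht with h | h
    · exact hF p hp k Y g hB M hM hT hD hC hr hs h
    · exact hP p hp k Y g hB M hM hT hD hC hr hs h

/-- the same for the families: `E1TopRefHeavy ⟺ E1TopRefFrozen ∧ E1TopRefPerpetual`. [new] [folklore] -/
theorem e1TopRefHeavy_iff_surface_perpetual : E1TopRefHeavy ↔ E1TopRefFrozen ∧ E1TopRefPerpetual := by
  constructor
  · intro h
    exact ⟨fun n hn => ((worTopRefHeavy_iff_surface_perpetual n).1 (h n hn)).1,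
      fun n hn => ((worTopRefHeavy_iff_surface_perpetual n).1 (h n hn)).2⟩
  · rintro ⟨hF, hP⟩ n hn
    exact (worTopRefHeavy_iff_surface_perpetual n).2 ⟨hF n hn, hP n hn⟩

/-- **THE RESIDUAL READ INTRINSICALLY**: `WORTopRefHeavy n` is weak resolution for ALL base `n`-data whose canonical bad run,
separating run AND refined run all fail to terminate — the three g23–g25 heaviness binders are implied (g26
`worTopSepHeavy_iff_intrinsic`). [new] [folklore] -/
theorem worTopRefHeavy_iff_intrinsic {n : ℕ} (hn : 1 ≤ n) :
    WORTopRefHeavy n ↔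
      ∀ p : ℕ, p.Prime → ∀ (k : Type) [Field k] [CharP k p] (Y : Scheme.{0}) (g : Y ⟶ Spec (.of k)),
        IsBase Y g → ∀ M : MarkedIdeal Y, IsDatum n M → ¬ RunTerminates n ⟨Y, M.ideal⟩ → ¬ SepTerminates n ⟨Y, M.ideal⟩ →
          ¬ RefTerminates n ⟨⟨Y, M.ideal⟩, none⟩ → ∃ t : CentreSeq Y, WeakResolution t M := by
  constructor
  · intro h p hp k _ _ Y g hB M hM hr hs ht
    haveI : IsLocallyNoetherian Y := isLocallyNoetherian_of_isBase hB
    have hC : TopChainHeavy Y M.ideal n := topChainHeavy_of_not_runTerminates hr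
    have hD : TopDeltaHeavy Y M.ideal n := topDeltaHeavy_of_topChainHeavy hp hB hn hM hC
    exact h p hp k Y g hB M hM (topHeavy_of_topDeltaHeavy hD) hD hC hr hs ht
  · intro h p hp k _ _ Y g hB M hM _ _ _ hr hs ht
    exact h p hp k Y g hB M hM hr hs ht

-- [WRITER NOTE (decomp-res writer g13)] the lens's closing corollary `sepFrozen_curve_refMoves` («g26's kind F-curve is absorbed by the DECIDED + P′ +
-- F-surface cells») is a statement-identical ALIAS of `SepFrozen.refMoves_of_dimLEOne` (§RefLaw, landed in this node's `DeltaCutRef*` files) — deleted here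
-- (gate `dedup.landed`); cite `SepFrozen.refMoves_of_dimLEOne hpre hne hirr hdim`.

end RefCells

end Summit.ResolutionOfSingularities.ResolutionOfSingularities.Theorems.DeltaCutClasses
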